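/-
Copyright (c) 2026. All rights reserved.
Released under Apache 2.0 license as described in the file LICENSE.
-/
import Mathlib
import Literature.Combinatorics.Hinz2018.ExponentialSubExponentialVariants

/-!
# Berend–Sapir: a solvable variant WITH A SHED is sub-exponential
# (Hinz–Klavžar–Petr 2018, Theorem 8.32, the 'if' half) — PROVED

Combinatorics/Hinz2018 support file for the named fact `MoveGraph.BerendSapirShedTheorem`
(`ExponentialSubExponentialVariants`, Theorem 8.32 of the book = [BerendSapir2016, Theorem 2]). This file
proves the half «if D contains a shed then TH(D) is sub-exponential» for every solvable digraph on a
finite peg type (`MoveGraph.subExponential_of_hasShed`), following the printed proof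
[cite: BerendSapir2016, §4: Lemma 2 (procedures ShedToInner / InnerToShed / Accumulate / Split),
proof of Theorem 2 (a) Cases 1–4 (ShedToG′, G′ToShed), Proposition 1] with two labelled deviations:

* the split. The paper moves the `m = ⌈n − n^α⌉` smallest discs back and forth (`α > 1/2`) and gets
  `|R_{w,n} → R_{v,n}| ≤ C λ^{n^α}`; for SUB-EXPONENTIALITY as the book defines it (`diam(H_D^n) ≤
  C_ε (1+ε)^n` for every `ε > 0`) a CONSTANT split `m = n − k` suffices: the same procedures give
  `a(n) ≤ (2k+1)·a(n−k) + B_k` (`lemma2_recursion`), whence `a(n) ≤ M ρ^n` as soon as `2k+1 < ρ^k`,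
  and for every `ρ > 1` such a `k` exists;
* Proposition 1 (`D_n ≤ (2n−1) d_n`, quoted from [8] = Berend–Sapir, IPL 2006) is replaced by the
  elementary `D_n ≤ 2n · max_{m ≤ n} d_m` (gather all discs onto the peg of the largest one, solve a
  perfect task, scatter), proved here (`ddiam_le_of_tasks`).

Dictionary (the tree's, `MoveGraphSolvability` / `ThreePegAlgorithm` / `ExponentialSubExponentialVariants`):
pegs `V` (finite), a state of `n` discs `Fin n → V` (index `0` = smallest disc), `H_D^n =
MoveGraph.stateDigraph D n`, counted walks `MoveGraph.ReachIn`, directed distance `MoveGraph.ddist`,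
`diam = MoveGraph.ddiam`, `SubExponential`, sheds `IsShed` / `HasShed` via strongly connected vertex
sets `IsStrongOn`, `Solvable`, `IsStrong`, and Theorem 8.7's engine `reachable_of_isStrong`.
The paper's `G′` is a strongly connected set `S ∌ w` with `3 ≤ |S|`; its entrance vertex `e`, exit
vertex `x` and an inner vertex `v ∈ S ∖ {e, x}` are `nonempty_shedAssumptions`.

No new definitions of mathematical content: the helpers below (`ReachLe`, state surgery `setLower` /
`setBlock`, the induced digraph on `↥S`) are tools. D-0026: no new named fact; nothing is restated.
-/

namespace Literature.Combinatorics.Hinz2018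

namespace MoveGraph

open Relation

/-! ## Tool: walks of bounded length -/

section ReachLe

variable {α : Type*} {R : α → α → Prop}

/-- [folklore] `ReachLe R B a b`: some directed `R`-walk from `a` to `b` has at most `B` arcs (tool for
the move counts of [cite: BerendSapir2016, §4]). -/
def ReachLe (R : α → α → Prop) (B : ℕ) (a b : α) : Prop :=
  ∃ m ≤ B, ReachIn R m a b

/-- [folklore] the empty walk -/
private theorem ReachLe.refl (B : ℕ) (a : α) : ReachLe R B a a :=
  ⟨0, Nat.zero_le _, rfl⟩

/-- [folklore] a counted walk is a bounded walk -/
private theorem ReachLe.of_reachIn {m : ℕ} {a b : α} (h : ReachIn R m a b) : ReachLe R m a b :=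
  ⟨m, le_rfl, h⟩

/-- [folklore] one arc -/
private theorem ReachLe.single {a b : α} (h : R a b) : ReachLe R 1 a b :=
  ReachLe.of_reachIn (reachIn_one h)

/-- [folklore] weakening the bound -/
private theorem ReachLe.mono {B B' : ℕ} (hB : B ≤ B') {a b : α} (h : ReachLe R B a b) : ReachLe R B' a b := by
  obtain ⟨m, hm, h⟩ := h
  exact ⟨m, hm.trans hB, h⟩

/-- [folklore] concatenation adds the bounds -/
private theorem ReachLe.trans {B B' : ℕ} {a b c : α} (h : ReachLe R B a b) (h' : ReachLe R B' b c) :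
    ReachLe R (B + B') a c := by
  obtain ⟨m, hm, h⟩ := h
  obtain ⟨m', hm', h'⟩ := h'
  exact ⟨m + m', Nat.add_le_add hm hm', reachIn_trans h h'⟩

/-- [folklore] more arcs, same walks -/
private theorem ReachLe.weaken {R' : α → α → Prop} (hRR' : ∀ a b, R a b → R' a b) {B : ℕ} {a b : α}
    (h : ReachLe R B a b) : ReachLe R' B a b := by
  obtain ⟨m, hm, h⟩ := h
  exact ⟨m, hm, h.mono hRR'⟩

/-- [folklore] mapping along a relation-preserving map -/
private theorem ReachLe.map {β : Type*} {P : β → β → Prop} (φ : α → β)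
    (hφ : ∀ a b, R a b → P (φ a) (φ b)) {B : ℕ} {a b : α} (h : ReachLe R B a b) :
    ReachLe P B (φ a) (φ b) := by
  obtain ⟨m, hm, h⟩ := h
  exact ⟨m, hm, h.map φ hφ⟩

/-- [folklore] a bounded walk bounds the directed distance -/
private theorem ReachLe.ddist_le {B : ℕ} {a b : α} (h : ReachLe R B a b) : ddist R a b ≤ B := by
  obtain ⟨m, hm, h⟩ := h
  exact (MoveGraph.ddist_le h).trans hm

/-- [folklore] a bounded walk is a walk -/
private theorem ReachLe.reflTransGen {B : ℕ} {a b : α} (h : ReachLe R B a b) : ReflTransGen R a b := by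
  obtain ⟨m, -, h⟩ := h
  exact reflTransGen_of_reachIn h

/-- [folklore] a reachable point is reached within the directed distance -/
private theorem reachLe_ddist {a b : α} (h : ReflTransGen R a b) : ReachLe R (ddist R a b) a b :=
  ReachLe.of_reachIn (reachIn_ddist h)

/-- [folklore] reversing a counted walk -/
private theorem reachIn_reverse {m : ℕ} {a b : α} (h : ReachIn R m a b) :
    ReachIn (fun x y => R y x) m b a := by
  induction m generalizing a with
  | zero => cases h; rfl
  | succ m ih =>
    obtain ⟨c, hac, hcb⟩ := h
    have h1 : ReachIn (fun x y => R y x) 1 c a := reachIn_one hac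
    have := reachIn_trans (ih hcb) h1
    simpa using this

end ReachLe

/-! ## Tool: state surgery — moving a block of consecutive discs inside a larger state -/

section Surgery

variable {V : Type*}

/-- [folklore] Replace the `m` smallest discs of a state of `n` discs by the state `t` (tool for
«the smallest m disks are moved (recursively)» [cite: BerendSapir2016, §4, Algorithm 2]). -/
def setLower {m n : ℕ} (f : Fin n → V) (t : Fin m → V) : Fin n → V :=
  fun d => if h : (d : ℕ) < m then t ⟨d, h⟩ else f d

/-- [folklore] Replace the block of discs `m, …, m+j−1` of a state of `n` discs by the state `u` of `j`
discs (tool for `MoveInG′`, «moves a set of disks D from vertex i to j, using G′ only»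
[cite: BerendSapir2016, §4, Algorithm 4]). -/
def setBlock {j n : ℕ} (m : ℕ) (f : Fin n → V) (u : Fin j → V) : Fin n → V :=
  fun d => if h : m ≤ (d : ℕ) ∧ (d : ℕ) < m + j then u ⟨d - m, by omega⟩ else f d

/-- [folklore] A legal move of the `m` smallest discs is a legal move of the whole state, whatever the
larger discs do (they never obstruct smaller discs). -/
private theorem stateAdj_setLower {A : V → V → Prop} {m n : ℕ} (hmn : m ≤ n) {s t : Fin m → V}
    (h : StateAdj A m s t) (f : Fin n → V) (hf : ∀ (d : Fin n) (hd : (d : ℕ) < m), f d = s ⟨d, hd⟩) :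
    StateAdj A n f (setLower f t) := by
  obtain ⟨d, had, hoff, hsm⟩ := h
  have hdn : (d : ℕ) < n := lt_of_lt_of_le d.isLt hmn
  have hfd : f ⟨d, hdn⟩ = s d := by rw [hf ⟨d, hdn⟩ d.isLt]
  have hgd : setLower f t ⟨d, hdn⟩ = t d := by simp [setLower]
  refine ⟨⟨d, hdn⟩, ?_, fun e he => ?_, fun e he => ?_⟩
  · rw [hfd, hgd]; exact had
  · by_cases hem : (e : ℕ) < m
    · have hne : (⟨e, hem⟩ : Fin m) ≠ d := fun h' => he (Fin.ext (by
        have := congrArg Fin.val h'; simpa using this))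
      simp only [setLower, hem, dif_pos]
      rw [hoff _ hne, hf e hem]
    · simp [setLower, hem]
  · have hem : (e : ℕ) < m := lt_trans (Fin.lt_def.mp he) d.isLt
    have hlt : (⟨e, hem⟩ : Fin m) < d := Fin.lt_def.mpr (Fin.lt_def.mp he)
    rw [hf e hem, hfd, hgd]
    exact hsm _ hlt

/-- [folklore] A counted walk of the `m` smallest discs lifts to a counted walk of the whole state of the
same length. -/
private theorem reachIn_setLower {A : V → V → Prop} {m n : ℕ} (hmn : m ≤ n) {l : ℕ} {s t : Fin m → V}
    (h : ReachIn (StateAdj A m) l s t) (f : Fin n → V)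
    (hf : ∀ (d : Fin n) (hd : (d : ℕ) < m), f d = s ⟨d, hd⟩) :
    ReachIn (StateAdj A n) l f (setLower f t) := by
  induction l generalizing s f with
  | zero =>
    have hst : s = t := h
    subst hst
    have : setLower f s = f := by
      funext d
      by_cases hd : (d : ℕ) < m
      · simp [setLower, hd, hf d hd]
      · simp [setLower, hd]
    rw [this]; rfl
  | succ l ih =>
    obtain ⟨s₁, hs₁, hrest⟩ := h
    refine ⟨setLower f s₁, stateAdj_setLower hmn hs₁ f hf, ?_⟩
    have key := ih hrest (setLower f s₁) (fun d hd => by simp [setLower, hd])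
    have heq : setLower (setLower f s₁) t = setLower f t := by
      funext d
      by_cases hd : (d : ℕ) < m <;> simp [setLower, hd]
    rw [heq] at key
    exact key

/-- [folklore] A legal move of the block of discs `m, …, m+j−1` along an arc avoiding the set `Q` of pegs
that carries all smaller discs is a legal move of the whole state (the larger discs never obstruct). -/
private theorem stateAdj_setBlock {A : V → V → Prop} {Q : Set V} {m j n : ℕ} (hmn : m + j ≤ n)
    {u u' : Fin j → V} (f : Fin n → V)
    (h : StateAdj (fun a b => A a b ∧ a ∉ Q ∧ b ∉ Q) j u u')
    (hQ : ∀ e : Fin n, (e : ℕ) < m → f e ∈ Q)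
    (hf : ∀ (d : Fin n) (h1 : m ≤ (d : ℕ)) (h2 : (d : ℕ) < m + j), f d = u ⟨d - m, by omega⟩) :
    StateAdj A n f (setBlock m f u') := by
  obtain ⟨d, ⟨had, haQ, hbQ⟩, hoff, hsm⟩ := h
  have hdn : m + (d : ℕ) < n := by have := d.isLt; omega
  set dd : Fin n := ⟨m + d, hdn⟩ with hdd
  have hidx : (⟨m + (d : ℕ) - m, by omega⟩ : Fin j) = d := Fin.ext (by simp)
  have hfd : f dd = u d := by
    rw [hf dd (by simp [hdd]) (by simp [hdd])]
    simp only [hdd]; rw [hidx]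
  have hgd : setBlock m f u' dd = u' d := by
    simp only [setBlock, hdd, le_add_iff_nonneg_right, zero_le, true_and, dif_pos,
      Nat.add_lt_add_iff_left, d.isLt]
    rw [hidx]
  refine ⟨dd, ?_, fun e he => ?_, fun e he => ?_⟩
  · rw [hfd, hgd]; exact had
  · by_cases hb : m ≤ (e : ℕ) ∧ (e : ℕ) < m + j
    · have hne : (⟨(e : ℕ) - m, by omega⟩ : Fin j) ≠ d := fun h' => he (Fin.ext (by
        have := congrArg Fin.val h'; simp at this; simp [hdd]; omega))
      simp only [setBlock, hb, and_self, dif_pos]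
      rw [hoff _ hne, hf e hb.1 hb.2]
    · simp [setBlock, hb]
  · have hlt : (e : ℕ) < m + d := by rw [Fin.lt_def] at he; simpa [hdd] using he
    by_cases hem : (e : ℕ) < m
    · have := hQ e hem
      rw [hfd, hgd]
      exact ⟨fun h' => haQ (h' ▸ this), fun h' => hbQ (h' ▸ this)⟩
    · push Not at hem
      have h2 : (e : ℕ) < m + j := by have := d.isLt; omega
      have hlt' : (⟨(e : ℕ) - m, by omega⟩ : Fin j) < d := by
        rw [Fin.lt_def]; simp; omega
      rw [hf e hem h2, hfd, hgd]
      exact hsm _ hlt'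

/-- [folklore] A counted walk of the block `m, …, m+j−1` along arcs avoiding the pegs `Q` of the smaller discs
lifts to a counted walk of the whole state of the same length. -/
private theorem reachIn_setBlock {A : V → V → Prop} {Q : Set V} {m j n : ℕ} (hmn : m + j ≤ n) {l : ℕ}
    {u u' : Fin j → V} (h : ReachIn (StateAdj (fun a b => A a b ∧ a ∉ Q ∧ b ∉ Q) j) l u u')
    (f : Fin n → V) (hQ : ∀ e : Fin n, (e : ℕ) < m → f e ∈ Q)
    (hf : ∀ (d : Fin n) (h1 : m ≤ (d : ℕ)) (h2 : (d : ℕ) < m + j), f d = u ⟨d - m, by omega⟩) :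
    ReachIn (StateAdj A n) l f (setBlock m f u') := by
  induction l generalizing u f with
  | zero =>
    have hu : u = u' := h
    subst hu
    have : setBlock m f u = f := by
      funext d
      by_cases hd : m ≤ (d : ℕ) ∧ (d : ℕ) < m + j
      · simp [setBlock, hd, hf d hd.1 hd.2]
      · simp [setBlock, hd]
    rw [this]; rfl
  | succ l ih =>
    obtain ⟨u₁, hu₁, hrest⟩ := h
    refine ⟨setBlock m f u₁, stateAdj_setBlock hmn f hu₁ hQ hf, ?_⟩
    have hQ' : ∀ e : Fin n, (e : ℕ) < m → setBlock m f u₁ e ∈ Q := fun e he => by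
      have : ¬ (m ≤ (e : ℕ) ∧ (e : ℕ) < m + j) := by omega
      simp only [setBlock, this, dif_neg, not_false_eq_true]
      exact hQ e he
    have key := ih hrest (setBlock m f u₁) hQ' (fun d h1 h2 => by simp [setBlock, h1, h2])
    have heq : setBlock m (setBlock m f u₁) u' = setBlock m f u' := by
      funext d
      by_cases hd : m ≤ (d : ℕ) ∧ (d : ℕ) < m + j <;> simp [setBlock, hd]
    rw [heq] at key
    exact key

/-- [folklore] A single disc `d` travels along a walk of pegs none of which carries a smaller disc
(«If a single disk can be moved uninterruptedly from a vertex to another, the number of moves is less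
than h.» [cite: BerendSapir2016, §4, proof of Theorem 2 (a)]). -/
theorem reachIn_update {A : V → V → Prop} {n : ℕ} (d : Fin n) {l : ℕ}
    (f : Fin n → V) {b : V}
    (h : ReachIn (fun x y => A x y ∧ ∀ e : Fin n, e < d → f e ≠ x ∧ f e ≠ y) l (f d) b) :
    ReachIn (StateAdj A n) l f (Function.update f d b) := by
  induction l generalizing f with
  | zero =>
    have hb : f d = b := h
    rw [← hb, Function.update_eq_self]; rfl
  | succ l ih =>
    obtain ⟨c, ⟨hac, hside⟩, hrest⟩ := h
    refine ⟨Function.update f d c, ⟨d, by simpa using hac, fun e he => by simp [he],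
      fun e he => by simpa using hside e he⟩, ?_⟩
    have hrest' : ReachIn (fun x y => A x y ∧ ∀ e : Fin n, e < d →
        Function.update f d c e ≠ x ∧ Function.update f d c e ≠ y) l (Function.update f d c d) b := by
      rw [Function.update_self]
      refine hrest.mono fun x y hxy => ⟨hxy.1, fun e he => ?_⟩
      rw [Function.update_of_ne (ne_of_lt he)]
      exact hxy.2 e he
    have key := ih (Function.update f d c) hrest'
    rwa [Function.update_idem] at key

end Surgery

/-! ## Tool: the variant restricted to a strongly connected vertex set (`G′` of the paper) -/

section Induce

variable {V : Type*}

/-- [folklore] The digraph induced by `D` on the vertex set `S` (the paper's `G′`, «a strongly connected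
subgraph of size at least 3 of the graph left after w is removed» [cite: BerendSapir2016, §4]). -/
abbrev induce (D : Digraph V) (S : Finset V) : Digraph ↥S where
  Adj a b := D.Adj a b

/-- [folklore] A strongly connected vertex set spans a strong induced digraph. -/
private theorem isStrong_induce {D : Digraph V} {S : Finset V} (hS : IsStrongOn D S) :
    IsStrong (induce D S) := by
  intro a b _
  have key : ∀ x y : V, ReflTransGen (fun x y => x ∈ S ∧ y ∈ S ∧ D.Adj x y) x y →
      ∀ (hx : x ∈ S) (hy : y ∈ S), ReflTransGen (induce D S).Adj ⟨x, hx⟩ ⟨y, hy⟩ := by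
    intro x y h
    induction h with
    | refl => intro hx hy; exact ReflTransGen.refl
    | tail _ hbc ih =>
      intro hx hy
      exact (ih hx hbc.1).tail (b := ⟨_, hbc.1⟩) hbc.2.2
  exact key a b (hS a a.2 b b.2) a.2 b.2

/-- [folklore] Moves of the induced variant are moves of `D` along arcs with both ends in `S`. -/
private theorem stateAdj_coe_induce {D : Digraph V} {S : Finset V} {j : ℕ} {f g : Fin j → ↥S}
    (h : StateAdj (induce D S).Adj j f g) :
    StateAdj (fun a b => D.Adj a b ∧ a ∈ S ∧ b ∈ S) j (fun d => (f d : V)) (fun d => (g d : V)) := by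
  obtain ⟨d, had, hoff, hsm⟩ := h
  refine ⟨d, ⟨had, (f d).2, (g d).2⟩, fun e he => by show (g e : V) = f e; rw [hoff e he],
    fun e he => ?_⟩
  obtain ⟨h1, h2⟩ := hsm e he
  exact ⟨fun h' => h1 (Subtype.ext h'), fun h' => h2 (Subtype.ext h')⟩

/-- «utilizing only the subgraph G′» [cite: BerendSapir2016, §4, Algorithm 4]: inside a strongly connected
set `S` with `3 ≤ |S|` any two states of `j` discs on pegs of `S` are joined by a walk along arcs with
both ends in `S` (Theorem 8.7's engine `reachable_of_isStrong` on the induced digraph). -/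
theorem reach_inside {D : Digraph V} {S : Finset V} (hS : IsStrongOn D S) (h3 : 3 ≤ S.card)
    (j : ℕ) (f g : Fin j → ↥S) :
    ReflTransGen (StateAdj (fun a b => D.Adj a b ∧ a ∈ S ∧ b ∈ S) j)
      (fun d => (f d : V)) (fun d => (g d : V)) := by
  have hcard : 3 ≤ Fintype.card ↥S := by simpa using h3
  have h := reachable_of_isStrong (isStrong_induce hS) hcard j f g
  exact ReflTransGen.lift (r := (stateDigraph (induce D S) j).Adj)
    (p := StateAdj (fun a b => D.Adj a b ∧ a ∈ S ∧ b ∈ S) j)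
    (fun f : Fin j → ↥S => fun d => (f d : V)) (fun _ _ h => stateAdj_coe_induce h) f g h

/-- [folklore] perfect tasks inside `S`: `u^j → v^j` along arcs inside `S`, for `u, v ∈ S`. -/
private theorem reach_inside_perfect {D : Digraph V} {S : Finset V} (hS : IsStrongOn D S) (h3 : 3 ≤ S.card)
    (j : ℕ) {u v : V} (hu : u ∈ S) (hv : v ∈ S) :
    ReflTransGen (StateAdj (fun a b => D.Adj a b ∧ a ∈ S ∧ b ∈ S) j)
      (fun _ : Fin j => u) (fun _ => v) :=
  reach_inside hS h3 j (fun _ => ⟨u, hu⟩) (fun _ => ⟨v, hv⟩)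

end Induce

/-! ## Tool: entrance and exit walks of the shed -/

section Entrance

variable {V : Type*}

/-- «Taking a shortest path from w ∈ V(G) − V(G′) to V(G′), we denote the entrance vertex to G′ − the
last vertex on this path and the only one that belongs to G′ − by e.» [cite: BerendSapir2016, §4,
before Example 1] — a walk to `e ∈ S` none of whose proper prefixes ends in `S` runs outside `S` and
enters `S` only at `e`. -/
theorem reachIn_entrance {R : V → V → Prop} {S : Finset V} {e : V} :
    ∀ (l : ℕ) (a : V), ReachIn R l a e → (∀ i < l, ∀ c, ReachIn R i a c → c ∉ S) →
      ReachIn (fun x y => R x y ∧ x ∉ S ∧ (y ∈ S → y = e)) l a e := by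
  intro l
  induction l with
  | zero => intro a h _; exact h
  | succ l ih =>
    intro a h hmin
    obtain ⟨c, hac, hce⟩ := h
    have ha : a ∉ S := hmin 0 (Nat.zero_lt_succ l) a rfl
    have hc : c ∈ S → c = e := by
      intro hcS
      rcases Nat.eq_zero_or_pos l with hl | hl
      · subst hl; exact hce
      · exact absurd hcS (hmin 1 (by omega) c (reachIn_one hac))
    exact ⟨c, ⟨hac, ha, hc⟩, ih c hce fun i hi c' hc' => hmin (i + 1) (by omega) c' ⟨c, hac, hc'⟩⟩

/-- The entrance walk exists [cite: BerendSapir2016, §4, before Example 1]: from `w ∉ S` a strong `D`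
reaches a nearest vertex `e ∈ S` (nonempty) by a walk of length `d(w, e)` outside `S`. -/
theorem exists_entrance {D : Digraph V} (hD : IsStrong D) {S : Finset V}
    (hS : S.Nonempty) {w : V} (hw : w ∉ S) :
    ∃ e ∈ S, ReachIn (fun x y => D.Adj x y ∧ x ∉ S ∧ (y ∈ S → y = e)) (ddist D.Adj w e) w e := by
  obtain ⟨e, he, hmin⟩ := Finset.exists_min_image S (fun u => ddist D.Adj w u) hS
  have hwe : w ≠ e := fun h => hw (h ▸ he)
  refine ⟨e, he, reachIn_entrance _ w (reachIn_ddist (hD w e hwe)) fun i hi c hc hcS => ?_⟩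
  have h1 := hmin c hcS
  have h2 : ddist D.Adj w c ≤ i := ddist_le hc
  omega

/-- «Similarly, an exit vertex x ∈ V(G′) is the first vertex on a shortest path leading from V(G′) to
w.» [cite: BerendSapir2016, §4, before Example 1] — obtained as an entrance walk of the reversed
digraph, reversed back. -/
theorem exists_exit {D : Digraph V} (hD : IsStrong D) {S : Finset V}
    (hS : S.Nonempty) {w : V} (hw : w ∉ S) :
    ∃ x ∈ S, ReachIn (fun a b => D.Adj a b ∧ b ∉ S ∧ (a ∈ S → a = x))
      (ddist (fun a b => D.Adj b a) w x) x w := by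
  have hD' : IsStrong (⟨fun a b => D.Adj b a⟩ : Digraph V) := by
    intro u v huv
    have h := hD v u (Ne.symm huv)
    clear huv
    induction h with
    | refl => exact ReflTransGen.refl
    | tail _ hbc ih => exact ReflTransGen.head hbc ih
  obtain ⟨x, hx, hwalk⟩ := exists_entrance hD' hS hw
  refine ⟨x, hx, ?_⟩
  have := reachIn_reverse hwalk
  exact this.mono fun a b h => ⟨h.1, h.2.1, h.2.2⟩

end Entrance

/-! ## The gadget of a shed: `G′ = S`, entrance `e`, exit `x`, inner vertex `v`; uniform constants -/

section Gadget

variable {V : Type*} [Fintype V]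

/-- [folklore] A uniform bound for the lengths of the vertex walks used (entrance and exit walks):
the largest directed distance in `D` and in its reverse. -/
noncomputable def pathBound (D : Digraph V) : ℕ :=
  Finset.univ.sup fun ab : V × V =>
    max (ddist D.Adj ab.1 ab.2) (ddist (fun a b => D.Adj b a) ab.1 ab.2)

/-- [folklore] -/
private theorem ddist_le_pathBound (D : Digraph V) (a b : V) : ddist D.Adj a b ≤ pathBound D := by
  have := Finset.le_sup (f := fun ab : V × V =>
    max (ddist D.Adj ab.1 ab.2) (ddist (fun a b => D.Adj b a) ab.1 ab.2)) (Finset.mem_univ (a, b))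
  exact le_trans (le_max_left _ _) this

/-- [folklore] -/
private theorem ddist_rev_le_pathBound (D : Digraph V) (a b : V) :
    ddist (fun a b => D.Adj b a) a b ≤ pathBound D := by
  have := Finset.le_sup (f := fun ab : V × V =>
    max (ddist D.Adj ab.1 ab.2) (ddist (fun a b => D.Adj b a) ab.1 ab.2)) (Finset.mem_univ (a, b))
  exact le_trans (le_max_right _ _) this

/-- [folklore] the arcs of `D` with both ends in `S` (the moves «using G′ only»
[cite: BerendSapir2016, §4, Algorithm 4]) -/
abbrev insideRel (D : Digraph V) (S : Finset V) : V → V → Prop :=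
  fun a b => D.Adj a b ∧ a ∈ S ∧ b ∈ S

/-- [folklore] A uniform bound `T_k` for the perfect tasks with at most `k` discs inside `S` (the constant
`C′ λ^{r−m}` of [cite: BerendSapir2016, §4, after Algorithm 3] for a constant split `r − m ≤ k`). -/
noncomputable def towerBound (D : Digraph V) (S : Finset V) (k : ℕ) : ℕ :=
  Finset.univ.sup fun t : Fin (k + 1) × V × V =>
    ddist (StateAdj (insideRel D S) t.1) (fun _ => t.2.1) (fun _ => t.2.2)

/-- [folklore] perfect tasks with `j ≤ k` discs inside `S` cost at most `towerBound D S k`. -/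
private theorem reachLe_tower {D : Digraph V} {S : Finset V} (hS : IsStrongOn D S) (h3 : 3 ≤ S.card)
    {k j : ℕ} (hj : j ≤ k) {u v : V} (hu : u ∈ S) (hv : v ∈ S) :
    ReachLe (StateAdj (insideRel D S) j) (towerBound D S k) (fun _ : Fin j => u) (fun _ => v) := by
  have h := reachLe_ddist (reach_inside_perfect hS h3 j hu hv)
  refine h.mono ?_
  exact Finset.le_sup (f := fun t : Fin (k + 1) × V × V =>
    ddist (StateAdj (insideRel D S) t.1) (fun _ => t.2.1) (fun _ => t.2.2))
    (Finset.mem_univ ((⟨j, Nat.lt_succ_of_le hj⟩ : Fin (k + 1)), u, v))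

/-- The data attached to a shed `w` and a strongly connected set `S ∌ w` [cite: BerendSapir2016, §4,
before Example 1 and before Lemma 2]: the entrance vertex `e` with its walk from `w` (outside `S` until
`e`), the exit vertex `x` with its walk to `w` (outside `S` after `x`), and an inner vertex
`v ∈ Inner = V(G′) − {e, x}`. [folklore] (a record of hypotheses, no mathematical content) -/
structure ShedAssumptions (D : Digraph V) (S : Finset V) (w : V) where
  /-- entrance vertex -/
  e : V
  /-- exit vertex -/
  x : V
  /-- inner vertex -/
  v : V
  he : e ∈ S
  hx : x ∈ S
  hv : v ∈ S
  hve : v ≠ e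
  hvx : v ≠ x
  hw : w ∉ S
  entrance : ReachLe (fun a b => D.Adj a b ∧ a ∉ S ∧ (b ∈ S → b = e)) (pathBound D) w e
  exit : ReachLe (fun a b => D.Adj a b ∧ b ∉ S ∧ (a ∈ S → a = x)) (pathBound D) x w

/-- The gadget exists for every `w ∉ S`, `S` strongly connected with `3 ≤ |S|`, `D` strong
[cite: BerendSapir2016, §4, before Example 1] («Let Inner = V(G′) − {e, x}.» is nonempty as
`|V(G′)| ≥ 3`). -/
theorem nonempty_shedAssumptions [DecidableEq V] {D : Digraph V} (hD : IsStrong D) {S : Finset V} (h3 : 3 ≤ S.card)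
    {w : V} (hw : w ∉ S) : Nonempty (ShedAssumptions D S w) := by
  have hne : S.Nonempty := Finset.card_pos.mp (by omega)
  obtain ⟨e, he, hwe⟩ := exists_entrance hD hne hw
  obtain ⟨x, hx, hxw⟩ := exists_exit hD hne hw
  have hv : ∃ v ∈ S, v ≠ e ∧ v ≠ x := by
    by_contra hcon
    push Not at hcon
    have hsub : S ⊆ {e, x} := by
      intro u hu
      by_cases hue : u = e
      · simp [hue]
      · simp [hcon u hu hue]
    have h1 := Finset.card_le_card hsub
    have h2 := Finset.card_le_two (a := e) (b := x)
    omega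
  obtain ⟨v, hv, hve, hvx⟩ := hv
  exact ⟨⟨e, x, v, he, hx, hv, hve, hvx, hw,
    (ReachLe.of_reachIn hwe).mono (ddist_le_pathBound D w e),
    (ReachLe.of_reachIn hxw).mono (ddist_rev_le_pathBound D w x)⟩⟩

/-! ## Lemma 2: `ShedToInner` / `InnerToShed` with a constant split -/

/-- [folklore] The states met by the procedures: discs `< m` on `a`, discs in `[m, r)` on `b`, disc `r`
on `c`, discs `> r` on `c'` (tool for «Immediately prior to iteration r, disks 1, 2, …, r−1 are at
vertex v, and disks r, r+1, …, n are at the shed vertex, w.» [cite: BerendSapir2016, §4, after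
Algorithm 3]). -/
def zones (n m r : ℕ) (a b c c' : V) : Fin n → V :=
  fun d => if (d : ℕ) < m then a else if (d : ℕ) < r then b else if (d : ℕ) = r then c else c'

/-- [folklore] The `m` smallest discs travel between any two of their states at the cost of the task,
whatever the larger discs do (every state of `H_D^m` is reachable from every other one for a strong `D`
on `≥ 3` pegs, `reachable_of_isStrong`). -/
private theorem reachLe_small {D : Digraph V} (hD : IsStrong D) (hV : 3 ≤ Fintype.card V) {m n : ℕ}
    (hmn : m ≤ n) (s t : Fin m → V) (f : Fin n → V)
    (hf : ∀ (d : Fin n) (hd : (d : ℕ) < m), f d = s ⟨d, hd⟩) :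
    ReachLe (stateDigraph D n).Adj (ddist (stateDigraph D m).Adj s t) f (setLower f t) :=
  ⟨_, le_rfl, reachIn_setLower hmn (reachIn_ddist (reachable_of_isStrong hD hV m s t)) f hf⟩

/-- [folklore] A block of `j ≤ k` consecutive discs `m, …, m+j−1`, all on `u ∈ S`, moves onto `u' ∈ S`
inside `S` within `towerBound D S k` moves, provided the smaller discs sit on the shed `w ∉ S`
(«using G′ only» [cite: BerendSapir2016, §4, Algorithm 4]). -/
theorem reachLe_block {D : Digraph V} {S : Finset V} (hS : IsStrongOn D S) (h3 : 3 ≤ S.card)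
    {w : V} (hw : w ∉ S) {k j m n : ℕ} (hj : j ≤ k) (hmn : m + j ≤ n) {u u' : V} (hu : u ∈ S)
    (hu' : u' ∈ S) (f : Fin n → V) (hsmall : ∀ e : Fin n, (e : ℕ) < m → f e = w)
    (hf : ∀ (d : Fin n), m ≤ (d : ℕ) → (d : ℕ) < m + j → f d = u) :
    ReachLe (stateDigraph D n).Adj (towerBound D S k) f (setBlock m f (fun _ : Fin j => u')) := by
  obtain ⟨l, hl, h⟩ := reachLe_tower hS h3 hj hu hu'
  refine ⟨l, hl, reachIn_setBlock (Q := {w}) hmn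
    (h.mono fun f' g' hfg => StateAdj.mono (fun a b hab => ⟨hab.1, ?_, ?_⟩) hfg) f
    (fun e he => by simp [hsmall e he]) (fun d h1 h2 => hf d h1 h2)⟩
  · simp only [Set.mem_singleton_iff]; rintro rfl; exact hw hab.2.1
  · simp only [Set.mem_singleton_iff]; rintro rfl; exact hw hab.2.2

section Steps

variable {D : Digraph V} {S : Finset V} {w : V} (G : ShedAssumptions D S w)

/-- Iteration `r` of ShedToInner, first step [cite: BerendSapir2016, §4, Algorithm 2]: «Disk r (whose
transfer is the goal of the iteration) is temporarily moved to vertex e.» — along the entrance walk,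
all smaller discs being on `v ∈ S ∖ {e}`. -/
theorem step_A1 {n m r : ℕ} (hmr : m ≤ r) (hrn : r < n) :
    ReachLe (stateDigraph D n).Adj (pathBound D) (zones n m r G.v G.v w w)
      (zones n m r G.v G.v G.e w) := by
  obtain ⟨l, hl, h⟩ := G.entrance
  have hfd : zones n m r G.v G.v w w ⟨r, hrn⟩ = w := by
    simp only [zones]; grind
  have key := reachIn_update (A := D.Adj) (⟨r, hrn⟩ : Fin n) (zones n m r G.v G.v w w) (b := G.e)
    (l := l) (by
      rw [hfd]
      refine h.mono fun a b hab => ⟨hab.1, fun e' he' => ?_⟩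
      have hv : zones n m r G.v G.v w w e' = G.v := by
        have : (e' : ℕ) < r := Fin.lt_def.mp he'
        simp only [zones]; grind
      rw [hv]
      refine ⟨fun h' => hab.2.1 (h' ▸ G.hv), fun h' => ?_⟩
      by_cases hb : b ∈ S
      · exact G.hve (h'.trans (hab.2.2 hb))
      · exact hb (h' ▸ G.hv))
  have heq : Function.update (zones n m r G.v G.v w w) ⟨r, hrn⟩ G.e = zones n m r G.v G.v G.e w := by
    funext d
    simp only [Function.update_apply, zones, Fin.ext_iff]
    grind
  rw [heq] at key
  exact ⟨l, hl, key⟩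

/-- Iteration `r` of ShedToInner, second step [cite: BerendSapir2016, §4, Algorithm 2]: «The smallest
m disks are moved from vertex v to the shed.» (InnerToShed(w, v, m), at the cost of that task). -/
theorem step_A2 (hD : IsStrong D) (hV : 3 ≤ Fintype.card V) {n m r : ℕ} (hmr : m ≤ r) (hrn : r < n) :
    ReachLe (stateDigraph D n).Adj (ddist (stateDigraph D m).Adj (fun _ : Fin m => G.v) (fun _ => w))
      (zones n m r G.v G.v G.e w) (zones n m r w G.v G.e w) := by
  have key := reachLe_small hD hV (show m ≤ n by omega) (fun _ : Fin m => G.v) (fun _ => w)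
    (zones n m r G.v G.v G.e w) (fun d hd => by simp only [zones]; grind)
  have heq : setLower (zones n m r G.v G.v G.e w) (fun _ : Fin m => w) = zones n m r w G.v G.e w := by
    funext d; simp only [setLower, zones, dite_eq_ite]; grind
  rw [heq] at key; exact key

/-- Iteration `r` of ShedToInner, third step, first half of Accumulate [cite: BerendSapir2016, §4,
Algorithm 4]: the block `m, …, r−1` moves from `v` onto disc `r` at `e`, inside `S`. -/
theorem step_A3 (hS : IsStrongOn D S) (h3 : 3 ≤ S.card) {n m r k : ℕ} (hmr : m ≤ r) (hrn : r < n)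
    (hk : r - m ≤ k) :
    ReachLe (stateDigraph D n).Adj (towerBound D S k)
      (zones n m r w G.v G.e w) (zones n m r w G.e G.e w) := by
  have key := reachLe_block hS h3 G.hw hk (show m + (r - m) ≤ n by omega) G.hv G.he
    (zones n m r w G.v G.e w) (fun d hd => by simp only [zones]; grind)
    (fun d h1 h2 => by simp only [zones]; grind)
  have heq : setBlock m (zones n m r w G.v G.e w) (fun _ : Fin (r - m) => G.e) =
      zones n m r w G.e G.e w := by
    funext d; simp only [setBlock, zones, dite_eq_ite]; grind
  rw [heq] at key; exact key

/-- Iteration `r` of ShedToInner, third step, second half of Accumulate [cite: BerendSapir2016, §4,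
Algorithm 4]: the block `m, …, r` moves from `e` to `v`, inside `S`. -/
theorem step_A4 (hS : IsStrongOn D S) (h3 : 3 ≤ S.card) {n m r k : ℕ} (hmr : m ≤ r) (hrn : r < n)
    (hk : r + 1 - m ≤ k) :
    ReachLe (stateDigraph D n).Adj (towerBound D S k)
      (zones n m r w G.e G.e w) (zones n m r w G.v G.v w) := by
  have key := reachLe_block hS h3 G.hw hk (show m + (r + 1 - m) ≤ n by omega) G.he G.hv
    (zones n m r w G.e G.e w) (fun d hd => by simp only [zones]; grind)
    (fun d h1 h2 => by simp only [zones]; grind)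
  have heq : setBlock m (zones n m r w G.e G.e w) (fun _ : Fin (r + 1 - m) => G.v) =
      zones n m r w G.v G.v w := by
    funext d; simp only [setBlock, zones, dite_eq_ite]; grind
  rw [heq] at key; exact key

/-- Iteration `r` of ShedToInner, last step [cite: BerendSapir2016, §4, Algorithm 2]: «The smallest m
disks are returned from the shed to vertex v.» -/
theorem step_A5 (hD : IsStrong D) (hV : 3 ≤ Fintype.card V) {n m r : ℕ} (hmr : m ≤ r) (hrn : r < n) :
    ReachLe (stateDigraph D n).Adj (ddist (stateDigraph D m).Adj (fun _ : Fin m => w) (fun _ => G.v))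
      (zones n m r w G.v G.v w) (zones n m (r + 1) G.v G.v w w) := by
  have key := reachLe_small hD hV (show m ≤ n by omega) (fun _ : Fin m => w) (fun _ => G.v)
    (zones n m r w G.v G.v w) (fun d hd => by simp only [zones]; grind)
  have heq : setLower (zones n m r w G.v G.v w) (fun _ : Fin m => G.v) =
      zones n m (r + 1) G.v G.v w w := by
    funext d; simp only [setLower, zones, dite_eq_ite]; grind
  rw [heq] at key; exact key

/-- ShedToInner with the split `m` [cite: BerendSapir2016, §4, Algorithm 2 and its analysis]: after the
initial call and `s` iterations the discs `< m + s` are on `v` and the others on the shed, within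
`f(m) + s·(h + f(m) + f′(m) + 2T)` moves. -/
theorem loopA (hD : IsStrong D) (hV : 3 ≤ Fintype.card V) (hS : IsStrongOn D S) (h3 : 3 ≤ S.card)
    {n m k : ℕ} (hnk : n ≤ m + k) :
    ∀ s : ℕ, m + s ≤ n → ReachLe (stateDigraph D n).Adj
      (ddist (stateDigraph D m).Adj (fun _ : Fin m => w) (fun _ => G.v) +
        s * (pathBound D + ddist (stateDigraph D m).Adj (fun _ : Fin m => G.v) (fun _ => w) +
          towerBound D S k + towerBound D S k +
          ddist (stateDigraph D m).Adj (fun _ : Fin m => w) (fun _ => G.v)))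
      (fun _ => w) (zones n m (m + s) G.v G.v w w) := by
  intro s
  induction s with
  | zero =>
    intro hs
    have key := reachLe_small hD hV (show m ≤ n by omega) (fun _ : Fin m => w) (fun _ => G.v)
      (fun _ : Fin n => w) (fun d hd => rfl)
    have heq : setLower (fun _ : Fin n => w) (fun _ : Fin m => G.v) = zones n m (m + 0) G.v G.v w w := by
      funext d; simp only [setLower, zones, dite_eq_ite]; grind
    rw [heq] at key
    simpa using key
  | succ s ih =>
    intro hs
    have h0 := ih (by omega)
    have h1 := step_A1 G (n := n) (m := m) (r := m + s) (by omega) (by omega)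
    have h2 := step_A2 G hD hV (n := n) (m := m) (r := m + s) (by omega) (by omega)
    have h3' := step_A3 G hS h3 (n := n) (m := m) (r := m + s) (k := k) (by omega) (by omega) (by omega)
    have h4 := step_A4 G hS h3 (n := n) (m := m) (r := m + s) (k := k) (by omega) (by omega) (by omega)
    have h5 := step_A5 G hD hV (n := n) (m := m) (r := m + s) (by omega) (by omega)
    have key := ((((h0.trans h1).trans h2).trans h3').trans h4).trans h5
    rw [show m + s + 1 = m + (s + 1) by omega] at key
    refine key.mono (le_of_eq ?_)
    ring

/-- InnerToShed, iteration `r`, first step, first half of Split [cite: BerendSapir2016, §4, Algorithm 3]: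
the block `m, …, r` moves from `v` to the exit vertex `x`, inside `S` (smaller discs on the shed). -/
theorem step_I1 (hS : IsStrongOn D S) (h3 : 3 ≤ S.card) {n m r k : ℕ} (hmr : m ≤ r) (hrn : r < n)
    (hk : r + 1 - m ≤ k) :
    ReachLe (stateDigraph D n).Adj (towerBound D S k)
      (zones n m (r + 1) w G.v w w) (zones n m r w G.x G.x w) := by
  have key := reachLe_block hS h3 G.hw hk (show m + (r + 1 - m) ≤ n by omega) G.hv G.hx
    (zones n m (r + 1) w G.v w w) (fun d hd => by simp only [zones]; grind)
    (fun d h1 h2 => by simp only [zones]; grind)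
  have heq : setBlock m (zones n m (r + 1) w G.v w w) (fun _ : Fin (r + 1 - m) => G.x) =
      zones n m r w G.x G.x w := by
    funext d; simp only [setBlock, zones, dite_eq_ite]; grind
  rw [heq] at key; exact key

/-- InnerToShed, iteration `r`, second half of Split [cite: BerendSapir2016, §4, Algorithm 3]: the block
`m, …, r−1` returns from `x` to `v`, leaving disc `r` at `x`. -/
theorem step_I2 (hS : IsStrongOn D S) (h3 : 3 ≤ S.card) {n m r k : ℕ} (hmr : m ≤ r) (hrn : r < n)
    (hk : r - m ≤ k) :
    ReachLe (stateDigraph D n).Adj (towerBound D S k)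
      (zones n m r w G.x G.x w) (zones n m r w G.v G.x w) := by
  have key := reachLe_block hS h3 G.hw hk (show m + (r - m) ≤ n by omega) G.hx G.hv
    (zones n m r w G.x G.x w) (fun d hd => by simp only [zones]; grind)
    (fun d h1 h2 => by simp only [zones]; grind)
  have heq : setBlock m (zones n m r w G.x G.x w) (fun _ : Fin (r - m) => G.v) =
      zones n m r w G.v G.x w := by
    funext d; simp only [setBlock, zones, dite_eq_ite]; grind
  rw [heq] at key; exact key

/-- InnerToShed, iteration `r`, third step [cite: BerendSapir2016, §4, Algorithm 3]: ShedToInner(w, v, m)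
frees the shed of the small discs. -/
theorem step_I3 (hD : IsStrong D) (hV : 3 ≤ Fintype.card V) {n m r : ℕ} (hmr : m ≤ r) (hrn : r < n) :
    ReachLe (stateDigraph D n).Adj (ddist (stateDigraph D m).Adj (fun _ : Fin m => w) (fun _ => G.v))
      (zones n m r w G.v G.x w) (zones n m r G.v G.v G.x w) := by
  have key := reachLe_small hD hV (show m ≤ n by omega) (fun _ : Fin m => w) (fun _ => G.v)
    (zones n m r w G.v G.x w) (fun d hd => by simp only [zones]; grind)
  have heq : setLower (zones n m r w G.v G.x w) (fun _ : Fin m => G.v) = zones n m r G.v G.v G.x w := by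
    funext d; simp only [setLower, zones, dite_eq_ite]; grind
  rw [heq] at key; exact key

/-- InnerToShed, iteration `r`, fourth step [cite: BerendSapir2016, §4, Algorithm 3]: disc `r` travels
from the exit vertex `x` to the shed along the exit walk `t_{x,w,r}` (all smaller discs on `v`). -/
theorem step_I4 {n m r : ℕ} (hmr : m ≤ r) (hrn : r < n) :
    ReachLe (stateDigraph D n).Adj (pathBound D) (zones n m r G.v G.v G.x w)
      (zones n m r G.v G.v w w) := by
  obtain ⟨l, hl, h⟩ := G.exit
  have hfd : zones n m r G.v G.v G.x w ⟨r, hrn⟩ = G.x := by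
    simp only [zones]; grind
  have key := reachIn_update (A := D.Adj) (⟨r, hrn⟩ : Fin n) (zones n m r G.v G.v G.x w) (b := w)
    (l := l) (by
      rw [hfd]
      refine h.mono fun a b hab => ⟨hab.1, fun e' he' => ?_⟩
      have hv : zones n m r G.v G.v G.x w e' = G.v := by
        have : (e' : ℕ) < r := Fin.lt_def.mp he'
        simp only [zones]; grind
      rw [hv]
      refine ⟨fun h' => ?_, fun h' => hab.2.1 (h' ▸ G.hv)⟩
      by_cases ha : a ∈ S
      · exact G.hvx (h'.trans (hab.2.2 ha))
      · exact ha (h' ▸ G.hv))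
  have heq : Function.update (zones n m r G.v G.v G.x w) ⟨r, hrn⟩ w = zones n m r G.v G.v w w := by
    funext d
    simp only [Function.update_apply, zones, Fin.ext_iff]
    grind
  rw [heq] at key
  exact ⟨l, hl, key⟩

/-- InnerToShed, iteration `r`, last step [cite: BerendSapir2016, §4, Algorithm 3]: InnerToShed(w, v, m)
puts the small discs back on the shed, on top of disc `r`. -/
theorem step_I5 (hD : IsStrong D) (hV : 3 ≤ Fintype.card V) {n m r : ℕ} (hmr : m ≤ r) (hrn : r < n) :
    ReachLe (stateDigraph D n).Adj (ddist (stateDigraph D m).Adj (fun _ : Fin m => G.v) (fun _ => w))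
      (zones n m r G.v G.v w w) (zones n m r w G.v w w) := by
  have key := reachLe_small hD hV (show m ≤ n by omega) (fun _ : Fin m => G.v) (fun _ => w)
    (zones n m r G.v G.v w w) (fun d hd => by simp only [zones]; grind)
  have heq : setLower (zones n m r G.v G.v w w) (fun _ : Fin m => w) = zones n m r w G.v w w := by
    funext d; simp only [setLower, zones, dite_eq_ite]; grind
  rw [heq] at key; exact key

/-- InnerToShed with the split `m` [cite: BerendSapir2016, §4, Algorithm 3]: after the initial call and
`s` iterations the discs `< m` are on the shed, the discs in `[m, n − s)` on `v` and the others on the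
shed, within `f′(m) + s·(2T + f(m) + h + f′(m))` moves. -/
theorem loopI (hD : IsStrong D) (hV : 3 ≤ Fintype.card V) (hS : IsStrongOn D S) (h3 : 3 ≤ S.card)
    {n m k : ℕ} (hmn : m ≤ n) (hnk : n ≤ m + k) :
    ∀ s : ℕ, m + s ≤ n → ReachLe (stateDigraph D n).Adj
      (ddist (stateDigraph D m).Adj (fun _ : Fin m => G.v) (fun _ => w) +
        s * (pathBound D + ddist (stateDigraph D m).Adj (fun _ : Fin m => G.v) (fun _ => w) +
          towerBound D S k + towerBound D S k +
          ddist (stateDigraph D m).Adj (fun _ : Fin m => w) (fun _ => G.v)))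
      (fun _ => G.v) (zones n m (n - s) w G.v w w) := by
  intro s
  induction s with
  | zero =>
    intro _
    have key := reachLe_small hD hV hmn (fun _ : Fin m => G.v) (fun _ => w)
      (fun _ : Fin n => G.v) (fun d hd => rfl)
    have heq : setLower (fun _ : Fin n => G.v) (fun _ : Fin m => w) = zones n m (n - 0) w G.v w w := by
      funext d; simp only [setLower, zones, dite_eq_ite]; grind
    rw [heq] at key
    simpa using key
  | succ s ih =>
    intro hs
    have h0 := ih (by omega)
    rw [show n - s = (n - s - 1) + 1 by omega] at h0
    have h1 := step_I1 G hS h3 (n := n) (m := m) (r := n - s - 1) (k := k)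
      (by omega) (by omega) (by omega)
    have h2 := step_I2 G hS h3 (n := n) (m := m) (r := n - s - 1) (k := k)
      (by omega) (by omega) (by omega)
    have h3' := step_I3 G hD hV (n := n) (m := m) (r := n - s - 1) (by omega) (by omega)
    have h4 := step_I4 G (n := n) (m := m) (r := n - s - 1) (by omega) (by omega)
    have h5 := step_I5 G hD hV (n := n) (m := m) (r := n - s - 1) (by omega) (by omega)
    have key := ((((h0.trans h1).trans h2).trans h3').trans h4).trans h5
    rw [show n - s - 1 = n - (s + 1) by omega] at key
    refine key.mono (le_of_eq ?_)
    ring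

/-- LEMMA 2 with a constant split [cite: BerendSapir2016, §4, Lemma 2 and inequality (3)]: writing
`f(n) = |R_{w,n} → R_{v,n}|`, `f′(n) = |R_{v,n} → R_{w,n}|` (directed distances of the perfect tasks),
for `k ≤ n`: `f(n), f′(n) ≤ (f + f′)(n−k)·(k) + f-or-f′(n−k) + k·(h + 2T_k)` — the printed count
«n − m + 1 calls to ShedToInner(w, v, m), n − m calls to InnerToShed(w, v, m), n − m transfers of a
single disk along a simple path in G, and n − m calls to Accumulate» with `n − m = k`. -/
theorem lemma2_recursion (hD : IsStrong D) (hV : 3 ≤ Fintype.card V) (hS : IsStrongOn D S)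
    (h3 : 3 ≤ S.card) {n k : ℕ} (hkn : k ≤ n) :
    ddist (stateDigraph D n).Adj (fun _ : Fin n => w) (fun _ => G.v) ≤
      ddist (stateDigraph D (n - k)).Adj (fun _ : Fin (n - k) => w) (fun _ => G.v) +
        k * (pathBound D + ddist (stateDigraph D (n - k)).Adj (fun _ : Fin (n - k) => G.v) (fun _ => w) +
          towerBound D S k + towerBound D S k +
          ddist (stateDigraph D (n - k)).Adj (fun _ : Fin (n - k) => w) (fun _ => G.v)) ∧
    ddist (stateDigraph D n).Adj (fun _ : Fin n => G.v) (fun _ => w) ≤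
      ddist (stateDigraph D (n - k)).Adj (fun _ : Fin (n - k) => G.v) (fun _ => w) +
        k * (pathBound D + ddist (stateDigraph D (n - k)).Adj (fun _ : Fin (n - k) => G.v) (fun _ => w) +
          towerBound D S k + towerBound D S k +
          ddist (stateDigraph D (n - k)).Adj (fun _ : Fin (n - k) => w) (fun _ => G.v)) := by
  constructor
  · have key := loopA G hD hV hS h3 (n := n) (m := n - k) (k := k) (by omega) k (by omega)
    have heq : zones n (n - k) (n - k + k) G.v G.v w w = fun _ => G.v := by
      funext d; have := d.isLt; simp only [zones]; grind
    rw [heq] at key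
    exact key.ddist_le
  · have key := loopI G hD hV hS h3 (n := n) (m := n - k) (k := k) (by omega) (by omega) k (by omega)
    have heq : zones n (n - k) (n - k) w G.v w w = fun _ => w := by
      funext d; simp only [zones]; grind
    rw [heq] at key
    exact key.ddist_le

end Steps

/-! ## Theorem 2 (a), Cases 1 and 2: `ShedToG′` and `G′ToShed` -/

section Cases

variable {D : Digraph V} {S : Finset V} {w : V} (G : ShedAssumptions D S w)

/-- CASE 1, the procedure ShedToG′ [cite: BerendSapir2016, §4, Algorithm 5]: a tower of `n` discs moves
from the shed `w` to any `j ∈ S` — «Moves all the disks from the shed to vertex v. Moves all disks but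
the largest in the set from v back to the shed. Moves the largest disk from vertex v to the
destination.» and recursively the rest; cost `Σ_{r<n} (f(r+1) + f′(r) + T_1)`. (For `j = v` the paper
uses Lemma 2 directly; the same recursion also covers it.) -/
theorem case1 (hD : IsStrong D) (hV : 3 ≤ Fintype.card V) (hS : IsStrongOn D S) (h3 : 3 ≤ S.card)
    {j : V} (hj : j ∈ S) :
    ∀ n : ℕ, ReachLe (stateDigraph D n).Adj
      (∑ r ∈ Finset.range n,
        (ddist (stateDigraph D (r + 1)).Adj (fun _ : Fin (r + 1) => w) (fun _ => G.v) +
          ddist (stateDigraph D r).Adj (fun _ : Fin r => G.v) (fun _ => w) + towerBound D S 1))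
      (fun _ => w) (fun _ => j) := by
  intro n
  induction n with
  | zero =>
    have : (fun _ : Fin 0 => w) = fun _ => j := funext fun d => d.elim0
    rw [this]; exact ReachLe.refl _ _
  | succ n ih =>
    -- 1. all `n+1` discs from the shed to `v`
    have h1 : ReachLe (stateDigraph D (n + 1)).Adj
        (ddist (stateDigraph D (n + 1)).Adj (fun _ : Fin (n + 1) => w) (fun _ => G.v))
        (fun _ => w) (fun _ => G.v) :=
      reachLe_ddist (reachable_of_isStrong hD hV (n + 1) _ _)
    -- 2. the `n` smaller discs back to the shed, disc `n` stays on `v`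
    have h2 := reachLe_small hD hV (Nat.le_succ n) (fun _ : Fin n => G.v) (fun _ => w)
      (fun _ : Fin (n + 1) => G.v) (fun d hd => rfl)
    have heq2 : setLower (fun _ : Fin (n + 1) => G.v) (fun _ : Fin n => w) =
        zones (n + 1) n n w w G.v G.v := by
      funext d; have := d.isLt; simp only [setLower, zones, dite_eq_ite]; grind
    rw [heq2] at h2
    -- 3. disc `n` from `v` to `j` inside `S` (a block of one disc; smaller discs on the shed)
    have h3' := reachLe_block hS h3 G.hw (k := 1) (j := 1) le_rfl (show n + 1 ≤ n + 1 from le_rfl)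
      G.hv hj (zones (n + 1) n n w w G.v G.v) (fun d hd => by simp only [zones]; grind)
      (fun d h1 h2 => by simp only [zones]; grind)
    have heq3 : setBlock n (zones (n + 1) n n w w G.v G.v) (fun _ : Fin 1 => j) =
        zones (n + 1) n n w w j j := by
      funext d; simp only [setBlock, zones, dite_eq_ite]; grind
    rw [heq3] at h3'
    -- 4. the `n` smaller discs from the shed to `j`, recursively, disc `n` idle on `j`
    obtain ⟨l, hl, hwalk⟩ := ih
    have h4 : ReachLe (stateDigraph D (n + 1)).Adj _ (zones (n + 1) n n w w j j)
        (setLower (zones (n + 1) n n w w j j) (fun _ : Fin n => j)) :=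
      ⟨l, hl, reachIn_setLower (Nat.le_succ n) hwalk _ (fun d hd => by simp only [zones]; grind)⟩
    have heq4 : setLower (zones (n + 1) n n w w j j) (fun _ : Fin n => j) = fun _ => j := by
      funext d; have := d.isLt; simp only [setLower, zones, dite_eq_ite]; grind
    rw [heq4] at h4
    have key := ((h1.trans h2).trans h3').trans h4
    refine key.mono (le_of_eq ?_)
    rw [Finset.sum_range_succ]
    ring

/-- CASE 2, the procedure G′ToShed [cite: BerendSapir2016, §4, Algorithm 6]: a tower of `n` discs moves
from any `i ∈ S` to the shed — recursively the `n−1` smaller discs first, then «T ← T ∗ t_{i,v,r};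
T ← T ∗ ShedToInner(w, v, r − 1); T ← T ∗ InnerToShed(w, v, r)»; cost
`Σ_{r<n} (T_1 + f(r) + f′(r+1))`. -/
theorem case2 (hD : IsStrong D) (hV : 3 ≤ Fintype.card V) (hS : IsStrongOn D S) (h3 : 3 ≤ S.card)
    {i : V} (hi : i ∈ S) :
    ∀ n : ℕ, ReachLe (stateDigraph D n).Adj
      (∑ r ∈ Finset.range n,
        (towerBound D S 1 + ddist (stateDigraph D r).Adj (fun _ : Fin r => w) (fun _ => G.v) +
          ddist (stateDigraph D (r + 1)).Adj (fun _ : Fin (r + 1) => G.v) (fun _ => w)))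
      (fun _ => i) (fun _ => w) := by
  intro n
  induction n with
  | zero =>
    have : (fun _ : Fin 0 => i) = fun _ => w := funext fun d => d.elim0
    rw [this]; exact ReachLe.refl _ _
  | succ n ih =>
    -- 1. the `n` smaller discs from `i` to the shed, recursively, disc `n` idle on `i`
    obtain ⟨l, hl, hwalk⟩ := ih
    have h1 : ReachLe (stateDigraph D (n + 1)).Adj _ (fun _ : Fin (n + 1) => i)
        (setLower (fun _ : Fin (n + 1) => i) (fun _ : Fin n => w)) :=
      ⟨l, hl, reachIn_setLower (Nat.le_succ n) hwalk _ (fun d hd => rfl)⟩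
    have heq1 : setLower (fun _ : Fin (n + 1) => i) (fun _ : Fin n => w) =
        zones (n + 1) n n w w i i := by
      funext d; have := d.isLt; simp only [setLower, zones, dite_eq_ite]; grind
    rw [heq1] at h1
    -- 2. disc `n` from `i` to `v` inside `S`
    have h2 := reachLe_block hS h3 G.hw (k := 1) (j := 1) le_rfl (show n + 1 ≤ n + 1 from le_rfl)
      hi G.hv (zones (n + 1) n n w w i i) (fun d hd => by simp only [zones]; grind)
      (fun d h1 h2 => by simp only [zones]; grind)
    have heq2 : setBlock n (zones (n + 1) n n w w i i) (fun _ : Fin 1 => G.v) =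
        zones (n + 1) n n w w G.v G.v := by
      funext d; simp only [setBlock, zones, dite_eq_ite]; grind
    rw [heq2] at h2
    -- 3. the `n` smaller discs from the shed onto disc `n` at `v`
    have h3' := reachLe_small hD hV (Nat.le_succ n) (fun _ : Fin n => w) (fun _ => G.v)
      (zones (n + 1) n n w w G.v G.v) (fun d hd => by simp only [zones]; grind)
    have heq3 : setLower (zones (n + 1) n n w w G.v G.v) (fun _ : Fin n => G.v) =
        fun _ => G.v := by
      funext d; have := d.isLt; simp only [setLower, zones, dite_eq_ite]; grind
    rw [heq3] at h3'
    -- 4. all `n+1` discs from `v` to the shed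
    have h4 : ReachLe (stateDigraph D (n + 1)).Adj
        (ddist (stateDigraph D (n + 1)).Adj (fun _ : Fin (n + 1) => G.v) (fun _ => w))
        (fun _ => G.v) (fun _ => w) :=
      reachLe_ddist (reachable_of_isStrong hD hV (n + 1) _ _)
    have key := ((h1.trans h2).trans h3').trans h4
    refine key.mono (le_of_eq ?_)
    rw [Finset.sum_range_succ]
    ring

/-- [folklore] The per-shed cost function `W_w(n) = f(n) + f′(n) + Σ_{r<n} (f(r+1) + f′(r+1) + f(r) +
f′(r) + T_1)` dominating Lemma 2's tasks and Cases 1–2 (bookkeeping for [cite: BerendSapir2016, §4,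
proof of Theorem 2 (a)]). -/
noncomputable def ShedAssumptions.shedCost (n : ℕ) : ℕ :=
  ddist (stateDigraph D n).Adj (fun _ : Fin n => w) (fun _ => G.v) +
    ddist (stateDigraph D n).Adj (fun _ : Fin n => G.v) (fun _ => w) +
    ∑ r ∈ Finset.range n,
      (ddist (stateDigraph D (r + 1)).Adj (fun _ : Fin (r + 1) => w) (fun _ => G.v) +
        ddist (stateDigraph D (r + 1)).Adj (fun _ : Fin (r + 1) => G.v) (fun _ => w) +
        ddist (stateDigraph D r).Adj (fun _ : Fin r => w) (fun _ => G.v) +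
        ddist (stateDigraph D r).Adj (fun _ : Fin r => G.v) (fun _ => w) + towerBound D S 1)

/-- Cases 1–2 and Lemma 2 together [cite: BerendSapir2016, §4, proof of Theorem 2 (a), Cases 1, 2]:
every perfect task between the shed `w` and a vertex of `S` costs at most `W_w(n)`. -/
theorem tasks_shed (hD : IsStrong D) (hV : 3 ≤ Fintype.card V) (hS : IsStrongOn D S)
    (h3 : 3 ≤ S.card) {j : V} (hj : j ∈ S) (n : ℕ) :
    ddist (stateDigraph D n).Adj (fun _ : Fin n => w) (fun _ => j) ≤ G.shedCost n ∧
      ddist (stateDigraph D n).Adj (fun _ : Fin n => j) (fun _ => w) ≤ G.shedCost n := by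
  constructor
  · refine (case1 G hD hV hS h3 hj n).ddist_le.trans ?_
    unfold ShedAssumptions.shedCost
    have : ∑ r ∈ Finset.range n,
        (ddist (stateDigraph D (r + 1)).Adj (fun _ : Fin (r + 1) => w) (fun _ => G.v) +
          ddist (stateDigraph D r).Adj (fun _ : Fin r => G.v) (fun _ => w) + towerBound D S 1) ≤
        ∑ r ∈ Finset.range n,
          (ddist (stateDigraph D (r + 1)).Adj (fun _ : Fin (r + 1) => w) (fun _ => G.v) +
            ddist (stateDigraph D (r + 1)).Adj (fun _ : Fin (r + 1) => G.v) (fun _ => w) +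
            ddist (stateDigraph D r).Adj (fun _ : Fin r => w) (fun _ => G.v) +
            ddist (stateDigraph D r).Adj (fun _ : Fin r => G.v) (fun _ => w) + towerBound D S 1) :=
      Finset.sum_le_sum fun r _ => by omega
    omega
  · refine (case2 G hD hV hS h3 hj n).ddist_le.trans ?_
    unfold ShedAssumptions.shedCost
    have : ∑ r ∈ Finset.range n,
        (towerBound D S 1 + ddist (stateDigraph D r).Adj (fun _ : Fin r => w) (fun _ => G.v) +
          ddist (stateDigraph D (r + 1)).Adj (fun _ : Fin (r + 1) => G.v) (fun _ => w)) ≤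
        ∑ r ∈ Finset.range n,
          (ddist (stateDigraph D (r + 1)).Adj (fun _ : Fin (r + 1) => w) (fun _ => G.v) +
            ddist (stateDigraph D (r + 1)).Adj (fun _ : Fin (r + 1) => G.v) (fun _ => w) +
            ddist (stateDigraph D r).Adj (fun _ : Fin r => w) (fun _ => G.v) +
            ddist (stateDigraph D r).Adj (fun _ : Fin r => G.v) (fun _ => w) + towerBound D S 1) :=
      Finset.sum_le_sum fun r _ => by omega
    omega

end Cases

/-! ## Proposition 1's substitute: the diameter against the perfect tasks -/

/-- [folklore] The largest perfect task `d_m = max_{i,j} |R_{i,m} → R_{j,m}|`, the little diameter of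
[cite: BerendSapir2016, §2] («which we call the little diameter of G(n)»), over `MoveGraph.ddist`. -/
noncomputable def littleDiam (D : Digraph V) (m : ℕ) : ℕ :=
  Finset.univ.sup fun ab : V × V =>
    ddist (stateDigraph D m).Adj (fun _ : Fin m => ab.1) (fun _ => ab.2)

/-- [folklore] -/
private theorem ddist_le_littleDiam (D : Digraph V) (m : ℕ) (a b : V) :
    ddist (stateDigraph D m).Adj (fun _ : Fin m => a) (fun _ => b) ≤ littleDiam D m :=
  Finset.le_sup (f := fun ab : V × V =>
    ddist (stateDigraph D m).Adj (fun _ : Fin m => ab.1) (fun _ => ab.2)) (Finset.mem_univ (a, b))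

/-- GATHERING [folklore] (our substitute for [cite: BerendSapir2016, §3, Proposition 1] = [8, Corollary
1]): any state of `n` discs is turned into any perfect state within `Σ_{m ≤ n} d_m` moves — gather the
`n−1` smaller discs onto the peg of the largest disc, then solve a perfect task. -/
theorem gather {D : Digraph V} (hD : IsStrong D) (hV : 3 ≤ Fintype.card V) :
    ∀ (n : ℕ) (s : Fin n → V) (a : V), ReachLe (stateDigraph D n).Adj
      (∑ m ∈ Finset.range n, littleDiam D (m + 1)) s (fun _ => a) := by
  intro n
  induction n with
  | zero =>
    intro s a
    have : s = fun _ => a := funext fun d => d.elim0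
    rw [this]; exact ReachLe.refl _ _
  | succ n ih =>
    intro s a
    set b : V := s (Fin.last n) with hb
    obtain ⟨l, hl, hwalk⟩ := ih (fun d : Fin n => s (Fin.castSucc d)) b
    have h1 : ReachLe (stateDigraph D (n + 1)).Adj _ s (setLower s (fun _ : Fin n => b)) :=
      ⟨l, hl, reachIn_setLower (Nat.le_succ n) hwalk s (fun d hd => by
        simp only [Fin.castSucc_mk, Fin.eta])⟩
    have heq : setLower s (fun _ : Fin n => b) = fun _ => b := by
      funext d
      by_cases hd : (d : ℕ) < n
      · simp [setLower, hd]
      · simp only [setLower, hd, dif_neg, not_false_eq_true, hb]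
        congr 1; exact Fin.ext (by have := d.isLt; simp; omega)
    rw [heq] at h1
    have h2 : ReachLe (stateDigraph D (n + 1)).Adj (littleDiam D (n + 1)) (fun _ => b) (fun _ => a) :=
      (reachLe_ddist (reachable_of_isStrong hD hV (n + 1) _ _)).mono (ddist_le_littleDiam D _ b a)
    refine (h1.trans h2).mono (le_of_eq ?_)
    rw [Finset.sum_range_succ]

/-- SCATTERING [folklore] (the reverse of `gather`): a perfect state is turned into any state of `n`
discs within `Σ_{m ≤ n} d_m` moves — solve the perfect task onto the target peg of the largest disc,
then spread the `n−1` smaller discs. -/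
private theorem scatter {D : Digraph V} (hD : IsStrong D) (hV : 3 ≤ Fintype.card V) :
    ∀ (n : ℕ) (t : Fin n → V) (a : V), ReachLe (stateDigraph D n).Adj
      (∑ m ∈ Finset.range n, littleDiam D (m + 1)) (fun _ => a) t := by
  intro n
  induction n with
  | zero =>
    intro t a
    have : (fun _ => a) = t := funext fun d => d.elim0
    rw [this]; exact ReachLe.refl _ _
  | succ n ih =>
    intro t a
    set b : V := t (Fin.last n) with hb
    have h1 : ReachLe (stateDigraph D (n + 1)).Adj (littleDiam D (n + 1)) (fun _ => a) (fun _ => b) :=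
      (reachLe_ddist (reachable_of_isStrong hD hV (n + 1) _ _)).mono (ddist_le_littleDiam D _ a b)
    obtain ⟨l, hl, hwalk⟩ := ih (fun d : Fin n => t (Fin.castSucc d)) b
    have h2 : ReachLe (stateDigraph D (n + 1)).Adj _ (fun _ : Fin (n + 1) => b)
        (setLower (fun _ : Fin (n + 1) => b) (fun d : Fin n => t (Fin.castSucc d))) :=
      ⟨l, hl, reachIn_setLower (Nat.le_succ n) hwalk _ (fun d hd => rfl)⟩
    have heq : setLower (fun _ : Fin (n + 1) => b) (fun d : Fin n => t (Fin.castSucc d)) = t := by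
      funext d
      by_cases hd : (d : ℕ) < n
      · simp only [setLower, hd, dif_pos, Fin.castSucc_mk, Fin.eta]
      · simp only [setLower, hd, dif_neg, not_false_eq_true, hb]
        congr 1; exact Fin.ext (by have := d.isLt; simp; omega)
    rw [heq] at h2
    refine (h1.trans h2).mono (le_of_eq ?_)
    rw [Finset.sum_range_succ, Nat.add_comm]

/-- The diameter against the little diameters [folklore] (our form of [cite: BerendSapir2016, §3,
Proposition 1], «D_n ≤ (2n−1) d_n»): `diam(H_D^n) ≤ 2 Σ_{m=1}^{n} d_m`. -/
theorem ddiam_le_sum_littleDiam {D : Digraph V} (hD : IsStrong D) (hV : 3 ≤ Fintype.card V) (n : ℕ) :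
    ddiam D n ≤ 2 * ∑ m ∈ Finset.range n, littleDiam D (m + 1) := by
  rw [ddiam_le_iff]
  intro f g
  obtain ⟨a⟩ : Nonempty V := Fintype.card_pos_iff.mp (by omega)
  have key := (gather hD hV n f a).trans (scatter hD hV n g a)
  have := key.ddist_le
  omega

/-! ## Analysis: from the `k`-step recursion to geometric bounds -/

section Analysis

open Filter Topology

/-- [folklore] A sequence with `A(n) ≤ α A(n−k) + β` (`n ≥ k ≥ 1`) is `O(ρ^n)` for every `ρ ≥ 1` with
`α < ρ^k` (the elementary substitute for the analysis of [cite: BerendSapir2016, §4, inequality (3)]). -/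
theorem exists_geometric_bound (A : ℕ → ℕ) {k α β : ℕ} (hk : 1 ≤ k) {ρ : ℝ} (hρ1 : 1 ≤ ρ)
    (hρ : (α : ℝ) < ρ ^ k) (hA : ∀ n, k ≤ n → A n ≤ α * A (n - k) + β) :
    ∃ M : ℝ, 0 ≤ M ∧ ∀ n, (A n : ℝ) ≤ M * ρ ^ n := by
  have hgap : 0 < ρ ^ k - α := by linarith
  set M : ℝ := (∑ i ∈ Finset.range k, (A i : ℝ)) + β / (ρ ^ k - α) with hM
  have hsum0 : 0 ≤ ∑ i ∈ Finset.range k, (A i : ℝ) := Finset.sum_nonneg fun i _ => Nat.cast_nonneg _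
  have hM0 : 0 ≤ M := add_nonneg hsum0 (div_nonneg (Nat.cast_nonneg _) hgap.le)
  refine ⟨M, hM0, fun n => ?_⟩
  induction n using Nat.strong_induction_on with
  | _ n ih =>
    by_cases hn : n < k
    · have h1 : (A n : ℝ) ≤ ∑ i ∈ Finset.range k, (A i : ℝ) :=
        Finset.single_le_sum (f := fun i => (A i : ℝ)) (fun i _ => Nat.cast_nonneg _)
          (Finset.mem_range.mpr hn)
      have h2 : (1 : ℝ) ≤ ρ ^ n := one_le_pow₀ hρ1
      have h3 : ∑ i ∈ Finset.range k, (A i : ℝ) ≤ M :=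
        le_add_of_nonneg_right (div_nonneg (Nat.cast_nonneg _) hgap.le)
      nlinarith
    · push Not at hn
      have hrec : (A n : ℝ) ≤ α * (A (n - k) : ℝ) + β := by exact_mod_cast hA n hn
      have hih := ih (n - k) (by omega)
      have hpow : ρ ^ n = ρ ^ (n - k) * ρ ^ k := by rw [← pow_add, Nat.sub_add_cancel hn]
      have h1 : (α : ℝ) * (A (n - k) : ℝ) ≤ α * (M * ρ ^ (n - k)) :=
        mul_le_mul_of_nonneg_left hih (Nat.cast_nonneg α)
      have h2 : (β : ℝ) ≤ M * (ρ ^ k - α) := by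
        rw [hM, add_mul, div_mul_cancel₀ _ hgap.ne']
        have : 0 ≤ (∑ i ∈ Finset.range k, (A i : ℝ)) * (ρ ^ k - α) := mul_nonneg hsum0 hgap.le
        linarith
      have h3 : (1 : ℝ) ≤ ρ ^ (n - k) := one_le_pow₀ hρ1
      have h4 : M * (ρ ^ k - α) ≤ M * ρ ^ (n - k) * (ρ ^ k - α) := by nlinarith
      rw [hpow]
      nlinarith

/-- [folklore] For every `ρ > 1` some constant split `k ≥ 1` has `2k + 2 < ρ^k` (exponentials beat
linear functions). -/
private theorem exists_split (ρ : ℝ) (hρ : 1 < ρ) : ∃ k : ℕ, 1 ≤ k ∧ ((2 * k + 2 : ℕ) : ℝ) < ρ ^ k := by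
  have hρ0 : 0 < ρ := by linarith
  have h : Tendsto (fun k : ℕ => (k : ℝ) ^ 1 * (ρ⁻¹) ^ k) atTop (𝓝 0) :=
    tendsto_pow_const_mul_const_pow_of_abs_lt_one 1
      (by rw [abs_of_pos (inv_pos.mpr hρ0)]; exact inv_lt_one_of_one_lt₀ hρ)
  have h2 := (h.eventually (gt_mem_nhds (by norm_num : (0 : ℝ) < 1 / 4))).and
    (eventually_ge_atTop 1)
  obtain ⟨k, hk1, hk2⟩ := h2.exists
  refine ⟨k, hk2, ?_⟩
  have hk1' : (k : ℝ) * (ρ⁻¹) ^ k < 1 / 4 := by simpa using hk1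
  rw [inv_pow, ← div_eq_mul_inv, div_lt_iff₀ (pow_pos hρ0 k)] at hk1'
  have : (1 : ℝ) ≤ k := by exact_mod_cast hk2
  push_cast
  linarith

/-- [folklore] A real sequence tending to `0` is bounded above. -/
private theorem exists_upper_of_tendsto_zero {g : ℕ → ℝ} (hg : Tendsto g atTop (𝓝 0)) :
    ∃ B : ℝ, ∀ n, g n ≤ B := by
  obtain ⟨B, hB⟩ := hg.bddAbove_range
  exact ⟨B, fun n => hB ⟨n, rfl⟩⟩

/-- [folklore] Polynomial times `ρ^n` against `σ^n`, `ρ < σ`: `(n+1)² ρ^n ≤ B σ^n`. -/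
private theorem exists_poly_geometric_bound {ρ σ : ℝ} (hρ : 0 < ρ) (hρσ : ρ < σ) :
    ∃ B : ℝ, ∀ n : ℕ, ((n : ℝ) + 1) ^ 2 * ρ ^ n ≤ B * σ ^ n := by
  have hσ : 0 < σ := hρ.trans hρσ
  have hq : |ρ / σ| < 1 := by
    rw [abs_of_pos (div_pos hρ hσ), div_lt_one hσ]; exact hρσ
  have h := tendsto_pow_const_mul_const_pow_of_abs_lt_one 2 hq
  have h' : Tendsto (fun n : ℕ => ((n + 1 : ℕ) : ℝ) ^ 2 * (ρ / σ) ^ (n + 1)) atTop (𝓝 0) :=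
    h.comp (tendsto_add_atTop_nat 1)
  obtain ⟨B0, hB0⟩ := exists_upper_of_tendsto_zero h'
  refine ⟨B0 * σ / ρ, fun n => ?_⟩
  have key := hB0 n
  push_cast at key
  have hσn1 : 0 < σ ^ (n + 1) := pow_pos hσ _
  rw [div_pow, ← mul_div_assoc, div_le_iff₀ hσn1] at key
  rw [show B0 * σ / ρ * σ ^ n = B0 * σ ^ (n + 1) / ρ by rw [pow_succ]; ring, le_div_iff₀ hρ]
  calc ((n : ℝ) + 1) ^ 2 * ρ ^ n * ρ = ((n : ℝ) + 1) ^ 2 * ρ ^ (n + 1) := by rw [pow_succ]; ring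
    _ ≤ B0 * σ ^ (n + 1) := key

/-- [folklore] Finite uniformisation: bounds `M_w` for finitely many `w` have a common upper bound. -/
private theorem exists_uniform {ι : Type*} (F : Finset ι) (P : ι → ℝ → Prop)
    (hmono : ∀ w M M', M ≤ M' → P w M → P w M') (h : ∀ w ∈ F, ∃ M : ℝ, 0 ≤ M ∧ P w M) :
    ∃ M : ℝ, 0 ≤ M ∧ ∀ w ∈ F, P w M := by
  classical
  induction F using Finset.induction_on with
  | empty => exact ⟨0, le_rfl, fun w hw => absurd hw (Finset.notMem_empty w)⟩
  | insert a F ha ih =>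
    obtain ⟨M1, hM1, h1⟩ := ih fun w hw => h w (Finset.mem_insert_of_mem hw)
    obtain ⟨M2, hM2, h2⟩ := h a (Finset.mem_insert_self a F)
    refine ⟨max M1 M2, le_max_of_le_left hM1, fun w hw => ?_⟩
    rcases Finset.mem_insert.mp hw with rfl | hw
    · exact hmono _ _ _ (le_max_right _ _) h2
    · exact hmono _ _ _ (le_max_left _ _) (h1 w hw)

end Analysis

/-! ## Assembly -/

section Assembly

variable {D : Digraph V} {S : Finset V} {w : V} (G : ShedAssumptions D S w)

/-- Lemma 2's recursion for the sum `A(n) = f(n) + f′(n)` [cite: BerendSapir2016, §4, Lemma 2]: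
`A(n) ≤ (2k+1) A(n−k) + 2k (h + 2T_k)` for `n ≥ k`. -/
theorem sum_recursion (hD : IsStrong D) (hV : 3 ≤ Fintype.card V) (hS : IsStrongOn D S)
    (h3 : 3 ≤ S.card) (k n : ℕ) (hkn : k ≤ n) :
    ddist (stateDigraph D n).Adj (fun _ : Fin n => w) (fun _ => G.v) +
        ddist (stateDigraph D n).Adj (fun _ : Fin n => G.v) (fun _ => w) ≤
      (2 * k + 1) * (ddist (stateDigraph D (n - k)).Adj (fun _ : Fin (n - k) => w) (fun _ => G.v) +
        ddist (stateDigraph D (n - k)).Adj (fun _ : Fin (n - k) => G.v) (fun _ => w)) +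
      2 * k * (pathBound D + 2 * towerBound D S k) := by
  obtain ⟨h1, h2⟩ := lemma2_recursion G hD hV hS h3 hkn
  set a := ddist (stateDigraph D (n - k)).Adj (fun _ : Fin (n - k) => w) (fun _ => G.v)
  set b := ddist (stateDigraph D (n - k)).Adj (fun _ : Fin (n - k) => G.v) (fun _ => w)
  set P := pathBound D
  set T := towerBound D S k
  have e1 : k * (P + b + T + T + a) = k * a + k * b + k * (P + 2 * T) := by ring
  have e2 : (2 * k + 1) * (a + b) + 2 * k * (P + 2 * T) =
      a + b + (k * a + k * b + k * (P + 2 * T)) + (k * a + k * b + k * (P + 2 * T)) := by ring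
  rw [e2]; rw [e1] at h1 h2
  omega

include G in
/-- The per-shed geometric bound [cite: BerendSapir2016, §4, proof of Theorem 2 (a)]: for `ρ ≥ 1` and a
split `k ≥ 1` with `2k+1 < ρ^k`, every perfect task between the shed `w` and a vertex of `S` costs at most
`(n+1)(2Mρ^n + T_1)` for a constant `M = M(w)`. -/
theorem exists_shed_bound (hD : IsStrong D) (hV : 3 ≤ Fintype.card V) (hS : IsStrongOn D S)
    (h3 : 3 ≤ S.card) {k : ℕ} (hk : 1 ≤ k) {ρ : ℝ} (hρ1 : 1 ≤ ρ)
    (hρ : ((2 * k + 1 : ℕ) : ℝ) < ρ ^ k) :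
    ∃ M : ℝ, 0 ≤ M ∧ ∀ (n : ℕ) (j : V), j ∈ S →
      (ddist (stateDigraph D n).Adj (fun _ : Fin n => w) (fun _ => j) : ℝ) ≤
          ((n : ℝ) + 1) * (2 * M * ρ ^ n + towerBound D S 1) ∧
        (ddist (stateDigraph D n).Adj (fun _ : Fin n => j) (fun _ => w) : ℝ) ≤
          ((n : ℝ) + 1) * (2 * M * ρ ^ n + towerBound D S 1) := by
  set A : ℕ → ℕ := fun n => ddist (stateDigraph D n).Adj (fun _ : Fin n => w) (fun _ => G.v) +
    ddist (stateDigraph D n).Adj (fun _ : Fin n => G.v) (fun _ => w) with hA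
  obtain ⟨M, hM0, hM⟩ := exists_geometric_bound A hk hρ1 hρ
    (β := 2 * k * (pathBound D + 2 * towerBound D S k))
    (fun n hn => by simpa [hA] using sum_recursion G hD hV hS h3 k n hn)
  refine ⟨M, hM0, fun n j hj => ?_⟩
  have hmono : ∀ r, r ≤ n → (A r : ℝ) ≤ M * ρ ^ n := fun r hr =>
    (hM r).trans (mul_le_mul_of_nonneg_left (pow_le_pow_right₀ hρ1 hr) hM0)
  have hcost : (G.shedCost n : ℝ) ≤ ((n : ℝ) + 1) * (2 * M * ρ ^ n + towerBound D S 1) := by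
    have hsum : ∀ r ∈ Finset.range n,
        ((ddist (stateDigraph D (r + 1)).Adj (fun _ : Fin (r + 1) => w) (fun _ => G.v) +
          ddist (stateDigraph D (r + 1)).Adj (fun _ : Fin (r + 1) => G.v) (fun _ => w) +
          ddist (stateDigraph D r).Adj (fun _ : Fin r => w) (fun _ => G.v) +
          ddist (stateDigraph D r).Adj (fun _ : Fin r => G.v) (fun _ => w) +
          towerBound D S 1 : ℕ) : ℝ) ≤ 2 * M * ρ ^ n + towerBound D S 1 := by
      intro r hr
      have hr' : r < n := Finset.mem_range.mp hr
      have e1 := hmono (r + 1) (by omega)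
      have e2 := hmono r (by omega)
      simp only [hA] at e1 e2
      push_cast at e1 e2 ⊢
      linarith
    have htot := Finset.sum_le_sum hsum
    rw [Finset.sum_const, Finset.card_range, nsmul_eq_mul] at htot
    have e0 := hmono n le_rfl
    simp only [hA] at e0
    unfold ShedAssumptions.shedCost
    push_cast at e0 htot ⊢
    have hT : (0 : ℝ) ≤ towerBound D S 1 := Nat.cast_nonneg _
    have hρn : (0 : ℝ) ≤ M * ρ ^ n := mul_nonneg hM0 (pow_nonneg (by linarith) n)
    nlinarith
  obtain ⟨h1, h2⟩ := tasks_shed G hD hV hS h3 hj n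
  exact ⟨(Nat.cast_le.mpr h1).trans hcost, (Nat.cast_le.mpr h2).trans hcost⟩

end Assembly

/-! ## Theorem 2 (a): a solvable variant with a shed is sub-exponential -/

/-- [folklore] triangle inequality of the directed distance (through reachable points). -/
private theorem ddist_triangle_of_reach {α : Type*} {R : α → α → Prop} {a b c : α} (h1 : ReflTransGen R a b)
    (h2 : ReflTransGen R b c) : ddist R a c ≤ ddist R a b + ddist R b c :=
  ((reachLe_ddist h1).trans (reachLe_ddist h2)).ddist_le

/-- THEOREM 8.32, the 'if' half (Berend–Sapir [cite: BerendSapir2016, Theorem 2 (a)], quoted in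
[cite: HinzKlavzarPetr2018, Ch. 8 §8.5, Theorem 8.32, p. 352]): «Specifically, we show how, given a shed,
we can indeed move a tower of disks from any peg to any other within O(λ^{n^α}) moves» — here in the
book's form: a SOLVABLE variant `TH(D)` on a finite peg set whose digraph has a shed is SUB-EXPONENTIAL,
`diam(H_D^n) ≤ C_ε (1 + ε)^n`. Proof: Cases 1–4 of the paper from `exists_shed_bound` (every vertex
outside `S` «may serve as a shed», Case 4), the little diameter `d_n ≤ 2(n+1)(2Mρ^n + T_1)` with
`ρ = 1 + ε/2`, and `diam(H_D^n) ≤ 2 Σ_{m ≤ n} d_m` (`ddiam_le_sum_littleDiam`). -/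
theorem subExponential_of_hasShed [DecidableEq V] {D : Digraph V} (hsol : Solvable D)
    (h : HasShed D) : SubExponential D := by
  classical
  obtain ⟨w0, S, hw0, h3, hS⟩ := h
  have hD : IsStrong D := isStrong_of_solvable hsol
  have hV : 3 ≤ Fintype.card V := h3.trans (Finset.card_le_univ S)
  have hSne : S.Nonempty := Finset.card_pos.mp (by omega)
  intro ε hε
  set σ : ℝ := 1 + ε with hσ
  set ρ : ℝ := 1 + ε / 2 with hρdef
  have hρ1 : 1 ≤ ρ := by rw [hρdef]; linarith
  have hρ1' : 1 < ρ := by rw [hρdef]; linarith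
  have hρσ : ρ < σ := by rw [hρdef, hσ]; linarith
  have hρ0 : 0 < ρ := by linarith
  obtain ⟨k, hk1, hk⟩ := exists_split ρ hρ1'
  have hk' : ((2 * k + 1 : ℕ) : ℝ) < ρ ^ k := by push_cast at hk ⊢; linarith
  set T1 : ℝ := (towerBound D S 1 : ℝ) with hT1
  have hT1pos : 0 ≤ T1 := Nat.cast_nonneg _
  -- the per-shed bounds (Lemma 2, Cases 1–2), for every vertex outside `S` as the shed (Case 4)
  set P : V → ℝ → Prop := fun w M => ∀ (n : ℕ) (j : V), j ∈ S →
      (ddist (stateDigraph D n).Adj (fun _ : Fin n => w) (fun _ => j) : ℝ) ≤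
          ((n : ℝ) + 1) * (2 * M * ρ ^ n + T1) ∧
        (ddist (stateDigraph D n).Adj (fun _ : Fin n => j) (fun _ => w) : ℝ) ≤
          ((n : ℝ) + 1) * (2 * M * ρ ^ n + T1) with hP
  have hmono : ∀ w M M', M ≤ M' → P w M → P w M' := by
    intro w M M' hMM' hw n j hj
    obtain ⟨e1, e2⟩ := hw n j hj
    have hgrow : ((n : ℝ) + 1) * (2 * M * ρ ^ n + T1) ≤ ((n : ℝ) + 1) * (2 * M' * ρ ^ n + T1) := by
      have := mul_nonneg (mul_nonneg (by positivity : (0 : ℝ) ≤ (n : ℝ) + 1) (sub_nonneg.mpr hMM'))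
        (pow_nonneg hρ0.le n)
      nlinarith
    exact ⟨e1.trans hgrow, e2.trans hgrow⟩
  have hper : ∀ w ∈ (Finset.univ.filter fun w : V => w ∉ S), ∃ M : ℝ, 0 ≤ M ∧ P w M := by
    intro w hw
    have hw' : w ∉ S := (Finset.mem_filter.mp hw).2
    obtain ⟨G⟩ := nonempty_shedAssumptions hD h3 hw'
    exact exists_shed_bound G hD hV hS h3 hk1 hρ1 hk'
  obtain ⟨M, hM0, hM⟩ := exists_uniform _ P hmono hper
  have hMw : ∀ w, w ∉ S → P w M := fun w hw => hM w (Finset.mem_filter.mpr ⟨Finset.mem_univ w, hw⟩)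
  -- the bound for all perfect tasks (Cases 3 and 4)
  set R : ℕ → ℝ := fun n => ((n : ℝ) + 1) * (2 * M * ρ ^ n + T1) with hR
  have hRpos : ∀ n, 0 ≤ R n := fun n => by
    simp only [hR]; exact mul_nonneg (by positivity) (add_nonneg (by positivity) hT1pos)
  have hRmono : ∀ m n, m ≤ n → R m ≤ R n := by
    intro m n hmn
    simp only [hR]
    have e1 : (m : ℝ) + 1 ≤ (n : ℝ) + 1 := by exact_mod_cast Nat.succ_le_succ hmn
    have e2 : ρ ^ m ≤ ρ ^ n := pow_le_pow_right₀ hρ1 hmn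
    have e4 : (0 : ℝ) ≤ (m : ℝ) + 1 := by positivity
    have s1 : ((m : ℝ) + 1) * (2 * M * ρ ^ m + T1) ≤ ((m : ℝ) + 1) * (2 * M * ρ ^ n + T1) :=
      mul_le_mul_of_nonneg_left (by nlinarith [mul_le_mul_of_nonneg_left e2 hM0]) e4
    have s2 : ((m : ℝ) + 1) * (2 * M * ρ ^ n + T1) ≤ ((n : ℝ) + 1) * (2 * M * ρ ^ n + T1) :=
      mul_le_mul_of_nonneg_right e1 (add_nonneg (by positivity) hT1pos)
    exact s1.trans s2
  have reach : ∀ (n : ℕ) (s t : Fin n → V), ReflTransGen (stateDigraph D n).Adj s t :=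
    fun n s t => reachable_of_isStrong hD hV n s t
  have htask : ∀ (n : ℕ) (a b : V),
      (ddist (stateDigraph D n).Adj (fun _ : Fin n => a) (fun _ => b) : ℝ) ≤ 2 * R n := by
    intro n a b
    by_cases hab : a = b
    · subst hab; rw [ddist_self]; simp only [Nat.cast_zero]; linarith [hRpos n]
    by_cases ha : a ∈ S
    · by_cases hb : b ∈ S
      · -- Case 3: through the shed `w0`
        have t := ddist_triangle_of_reach (reach n (fun _ => a) (fun _ => w0)) (reach n (fun _ => w0) (fun _ => b))
        have e1 := ((hMw w0 hw0) n a ha).2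
        have e2 := ((hMw w0 hw0) n b hb).1
        have : (ddist (stateDigraph D n).Adj (fun _ : Fin n => a) (fun _ => b) : ℝ) ≤
            (ddist (stateDigraph D n).Adj (fun _ : Fin n => a) (fun _ => w0) : ℝ) +
              ddist (stateDigraph D n).Adj (fun _ : Fin n => w0) (fun _ => b) := by exact_mod_cast t
        linarith
      · -- `b` outside `S` is a shed (Case 2 for the shed `b`)
        have e1 := ((hMw b hb) n a ha).2
        linarith [hRpos n]
    · by_cases hb : b ∈ S
      · -- Case 1 for the shed `a`
        have e1 := ((hMw a ha) n b hb).1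
        linarith [hRpos n]
      · -- Case 4: both outside `S`, through a vertex of `S`
        obtain ⟨c, hc⟩ := hSne
        have t := ddist_triangle_of_reach (reach n (fun _ => a) (fun _ => c)) (reach n (fun _ => c) (fun _ => b))
        have e1 := ((hMw a ha) n c hc).1
        have e2 := ((hMw b hb) n c hc).2
        have : (ddist (stateDigraph D n).Adj (fun _ : Fin n => a) (fun _ => b) : ℝ) ≤
            (ddist (stateDigraph D n).Adj (fun _ : Fin n => a) (fun _ => c) : ℝ) +
              ddist (stateDigraph D n).Adj (fun _ : Fin n => c) (fun _ => b) := by exact_mod_cast t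
        linarith
  have hlittle : ∀ n, (littleDiam D n : ℝ) ≤ 2 * R n := by
    intro n
    obtain ⟨a⟩ : Nonempty V := Fintype.card_pos_iff.mp (by omega)
    obtain ⟨ab, -, hab⟩ := Finset.exists_mem_eq_sup (Finset.univ : Finset (V × V))
      ⟨(a, a), Finset.mem_univ _⟩
      (fun ab : V × V => ddist (stateDigraph D n).Adj (fun _ : Fin n => ab.1) (fun _ => ab.2))
    unfold littleDiam
    rw [hab]
    exact htask n ab.1 ab.2
  -- the diameter
  have hdiam : ∀ n, (ddiam D n : ℝ) ≤ 4 * ((n : ℝ) + 1) * R n := by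
    intro n
    have h0 := ddiam_le_sum_littleDiam hD hV n
    have h1 : (ddiam D n : ℝ) ≤ 2 * ∑ m ∈ Finset.range n, (littleDiam D (m + 1) : ℝ) := by
      exact_mod_cast h0
    have h2 : ∑ m ∈ Finset.range n, (littleDiam D (m + 1) : ℝ) ≤ ∑ m ∈ Finset.range n, 2 * R n :=
      Finset.sum_le_sum fun m hm =>
        (hlittle (m + 1)).trans (by linarith [hRmono (m + 1) n (Finset.mem_range.mp hm)])
    rw [Finset.sum_const, Finset.card_range, nsmul_eq_mul] at h2
    have e4 : (n : ℝ) ≤ (n : ℝ) + 1 := by linarith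
    nlinarith [hRpos n]
  -- polynomial factors against `(1+ε)^n / ρ^n`
  obtain ⟨B, hB⟩ := exists_poly_geometric_bound hρ0 hρσ
  refine ⟨4 * (2 * M + T1) * B, fun n => (hdiam n).trans ?_⟩
  have hB' := hB n
  have e1 : R n ≤ ((n : ℝ) + 1) * ((2 * M + T1) * ρ ^ n) := by
    simp only [hR]
    have : T1 ≤ T1 * ρ ^ n := le_mul_of_one_le_right hT1pos (one_le_pow₀ hρ1)
    have e0 : (0 : ℝ) ≤ (n : ℝ) + 1 := by positivity
    nlinarith
  have e2 : 4 * ((n : ℝ) + 1) * R n ≤ 4 * (2 * M + T1) * (((n : ℝ) + 1) ^ 2 * ρ ^ n) := by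
    have e0 : (0 : ℝ) ≤ (n : ℝ) + 1 := by positivity
    nlinarith [mul_le_mul_of_nonneg_left e1 e0]
  have e3 : 4 * (2 * M + T1) * (((n : ℝ) + 1) ^ 2 * ρ ^ n) ≤ 4 * (2 * M + T1) * (B * σ ^ n) :=
    mul_le_mul_of_nonneg_left hB' (by positivity)
  rw [hσ] at e3
  linarith

end Gadget





end MoveGraph

end Literature.Combinatorics.Hinz2018
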